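import Summits.Ventures.HodgeRepro2.HostAPI.Carriers.AlgebraicGeometry.HodgeTheory.AlgebraicClasses
import Summits.Ventures.HodgeRepro2.HostAPI.Carriers.AlgebraicGeometry.HodgeTheory.RationalHodgeClasses
import Summits.Ventures.HodgeRepro2.HostAPI.Util.ForallBinderLint
open HostAPI.Carriers

noncomputable section

namespace HostAPI.Carriers.AlgebraicGeometry.HodgeTheory

section HodgeTheory

def HodgeConjectureFor (n : ℕ) (X : Motives.SchemeOver ℂ) : Prop :=
  Nonempty (HodgeModel n X) ∧
    ∀ (p : ℕ) (c : HostAPI.Carriers.AlgebraicTopology.SingularHomology.singularCohomology ℂ ℂ (Motives.ComplexPoints X) (2 * p)),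
      IsRationalClass c → IsOfHodgeType n X (2 * p) p p c → c ∈ algebraicClasses X p

variable {n : ℕ} {X : Motives.SchemeOver ℂ}

theorem hodgeConjectureFor_iff : HodgeConjectureFor n X ↔ Nonempty (HodgeModel n X) ∧
    ∀ (p : ℕ) (c : HostAPI.Carriers.AlgebraicTopology.SingularHomology.singularCohomology ℂ ℂ (Motives.ComplexPoints X) (2 * p)),
      IsRationalClass c → IsOfHodgeType n X (2 * p) p p c → c ∈ algebraicClasses X p :=
  Iff.rfl

theorem hodgeConjectureFor_codim_zero (c : HostAPI.Carriers.AlgebraicTopology.SingularHomology.singularCohomology ℂ ℂ (Motives.ComplexPoints X) (2 * 0)) :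
    c ∈ algebraicClasses X 0 := by
  rw [algebraicClasses_zero]
  exact Submodule.mem_top

theorem hodgeConjectureFor_iff_of_hodgeModel (A : HodgeModel n X) :
    HodgeConjectureFor n X ↔
      ∀ (p : ℕ) (c : HostAPI.Carriers.AlgebraicTopology.SingularHomology.singularCohomology ℂ ℂ (Motives.ComplexPoints X) (2 * p)),
        IsRationalClass c → IsOfHodgeType n X (2 * p) p p c → c ∈ algebraicClasses X p :=
  ⟨fun h ↦ h.2, fun h ↦ ⟨⟨A⟩, h⟩⟩

end HodgeTheory

end HostAPI.Carriers.AlgebraicGeometry.HodgeTheory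

end
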